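import Literature.AlgebraicGeometry.Liu2021.AdmissibleElement
import Literature.NumberTheory.NumberFields.PrescribedSignsPrescribedSquareClass
import HarnessLib

/-!
# Liu 2021, Def. 4.12: a `μ`-admissible element `a·δ` whose REAL PART `a ∈ (E⁺)ˣ` lies in PRESCRIBED LOCAL SQUARE CLASSES (proved)

Topic `AlgebraicGeometry/Liu2021`; namespace `Literature.AlgebraicGeometry.Liu2021` (home of ★ `IsAdmissibleElement`).  THEOREMS ONLY (no definition,
no named fact, no instance, no notation, no `sorry`).  [Liu2021, Def. 4.12] indexes the theta lifts of Prop. 4.13 ∕ Thm. 4.18 by the `μ`-ADMISSIBLE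
collections `ε = (e · Nm E_vˣ)_v`, `e ∈ E^{×,−}` with `Im τ′(e) < 0` for all `τ′ ∈ Φ_μ` (★ `IsAdmissibleElement`).  ★ `exists_isAdmissibleElement` gives SOME
admissible `e`; here we prescribe, in addition, the local square classes of its real part at finitely many finite places:

* `im_embedding_ne_zero_of_complexConj_eq_neg` — a non-zero purely imaginary `δ` has `Im τ(δ) ≠ 0` at every complex embedding;
* **`exists_isAdmissibleElement_algebraMap_mul_forall_isSquare_div`** — for a CM field `E`, a set `Φ` of complex embeddings containing no
  complex-conjugate pair (every CM type), a purely imaginary `δ ≠ 0`, a finite set `S` of finite places of `E⁺` and units `κ_v ∈ (E⁺_v)ˣ`: there is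
  `a ∈ (E⁺)ˣ` with `a · δ` admissible for `Φ` AND `a / κ_v ∈ (E⁺_v)²` for every `v ∈ S` (so `a ≡ κ_v` modulo every local norm group ⊇ squares, in
  particular modulo `Nm_{E_w/E⁺_v} E_wˣ`); one-place forms `exists_isAdmissibleElement_algebraMap_mul_isSquare_div`, `…_eq_mul_sq`.

Proof: weak approximation with prescribed signs (★ `NumberFields.exists_sign_at_isReal_forall_isSquare_div`), the sign at the real place `w` of `E⁺` being
that of `−Im τ_w(δ)` for the member `τ_w ∈ Φ` of the conjugate pair of embeddings of `E` above `w` (Mathlib `IsCMField.equivInfinitePlace`,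
`InfinitePlace.embedding_mk_eq`); then `Im τ(a δ) = σ_w(a) · Im τ(δ) < 0` for `τ ∈ Φ` above `w`.  Cell hodgecm-mathlib use (crux H413, line LH10 «(D-b)ᵀ», organ (WAᴸ)):
the GLOBAL hermitian line `⟨a⟩` through the supercuspidal local theta class at a non-split place [GelbartRogawski1991, Lem. 5.1.2] with `⟨a⟩` `μ`-admissible,
the index under which the tree's Θ-OCC-GEN (`F0P2tThetaOccursInGenNeg.thetaOccursInGen`) produces the global theta lift (`epsOf (a·δ′) = locF a`, ★
`Def411WeilCarriers.epsOf_algebraMap_mul`).  HC_CM is proved only modulo the printed citations until rung 0 closes; this file discharges none of them.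

## References
* [Liu2021] Y. Liu, Camb. J. Math. 9 (2021) 1–147 = arXiv:2102.11518 — Def. 4.12 (l. 2102–2108), Def. 4.11.
* [CasselsFrohlichANT1967] Cassels–Fröhlich (eds.), *Algebraic Number Theory* (1967), Ch. II §6 (weak approximation).
* [Omeara1963] O. T. O'Meara, *Introduction to quadratic forms* (1963), §63A Cor. 63:1b.
* [GelbartRogawski1991] S. Gelbart, J. Rogawski, Invent. Math. 105 (1991), Lem. 5.1.2 p. 466.
-/

noncomputable section

namespace Literature.AlgebraicGeometry.Liu2021

open NumberField NumberField.InfinitePlace NumberField.ComplexEmbedding IsDedekindDomain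
open scoped ComplexConjugate

variable {E : Type} [Field E] [NumberField E] [IsCMField E]

/-! ## §1 Purely imaginary elements and real parts at the complex embeddings -/

/-- A non-zero purely imaginary element `δ` (`δ̄ = −δ`) of a CM field has NON-ZERO imaginary part at every complex embedding (its real part vanishes:
`conj τ(δ) = τ(δ̄) = −τ(δ)`). [cite: Liu2021, Def. 4.12; §4 preamble (`E^− = {e : e + e^c = 0}`)] -/
theorem im_embedding_ne_zero_of_complexConj_eq_neg {δ : E} (hδ : IsCMField.complexConj E δ = -δ) (hδ0 : δ ≠ 0) (τ : E →+* ℂ) :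
    (τ δ).im ≠ 0 := by
  have hre : (τ δ).re = 0 := by
    have h := IsCMField.complexEmbedding_complexConj E τ δ
    rw [hδ, map_neg] at h
    have h2 := congrArg Complex.re h
    rw [Complex.neg_re, Complex.conj_re] at h2
    linarith
  intro him
  exact (map_ne_zero τ).2 hδ0 (Complex.ext hre him)

/-- An element of the maximal real subfield is REAL at every complex embedding: `τ(a) = σ_w(a)` for the real place `w = (mk τ)|_{E⁺}` of `E⁺`
(`σ_w` its real embedding) — the real primes of `E⁺` are its real embeddings, and every embedding of the CM field `E` is real on `E⁺`.
[cite: NeukirchANT1999, Ch. III §1 (infinite primes = real embeddings and pairs of complex embeddings, p. 184)] -/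
theorem embedding_algebraMap_eq_ofReal_embedding_of_isReal (τ : E →+* ℂ) (a : ↥(maximalRealSubfield E)) :
    τ (algebraMap ↥(maximalRealSubfield E) E a) =
      ((embedding_of_isReal (w := (InfinitePlace.mk τ).comap (algebraMap ↥(maximalRealSubfield E) E))
        (IsTotallyReal.isReal _) a : ℝ) : ℂ) := by
  have hreal : ComplexEmbedding.IsReal (τ.comp (algebraMap ↥(maximalRealSubfield E) E)) := by
    rw [ComplexEmbedding.isReal_iff]
    ext x
    rw [conjugate_coe_eq, RingHom.comp_apply, ← IsCMField.complexEmbedding_complexConj]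
    exact congrArg τ (IsCMField.complexConj_apply_eq_self (K := E) x)
  rw [embedding_of_isReal_apply, comap_mk, embedding_mk_eq_of_isReal hreal, RingHom.comp_apply]

/-! ## §2 Admissible elements with a real part in prescribed local square classes -/

/-- **[Liu2021, Def. 4.12] with prescribed local classes.**  For a CM field `E`, a set `Φ` of complex embeddings with no complex-conjugate pair (e.g. a CM type
`Φ_μ`), a purely imaginary `δ ≠ 0`, a finite set `S` of finite places of `E⁺` and `κ_v ∈ (E⁺_v)ˣ`: there is `a ∈ (E⁺)ˣ` such that `a·δ` is `Φ`-ADMISSIBLE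
(`a δ ≠ 0`, `\overline{aδ} = −aδ`, `Im τ′(aδ) < 0` for all `τ′ ∈ Φ`) and `a / κ_v` is a square in `E⁺_v` for every `v ∈ S`.  Weak approximation in `E⁺` at `S ∪ ∞`
with the sign of `−Im τ_w(δ)` at the real place `w`, `τ_w ∈ Φ` above `w`. [cite: Liu2021, Def. 4.12] [cite: CasselsFrohlichANT1967, Ch. II §6 Lemma (weak approximation)] -/
theorem exists_isAdmissibleElement_algebraMap_mul_forall_isSquare_div (Φ : Set (E →+* ℂ)) (hΦ : ∀ φ ∈ Φ, conjugate φ ∉ Φ)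
    {δ : E} (hδ : IsCMField.complexConj E δ = -δ) (hδ0 : δ ≠ 0)
    (S : Finset (HeightOneSpectrum (𝓞 ↥(maximalRealSubfield E))))
    (κ : ∀ v : HeightOneSpectrum (𝓞 ↥(maximalRealSubfield E)), (v.adicCompletion ↥(maximalRealSubfield E))ˣ) :
    ∃ a : (↥(maximalRealSubfield E))ˣ,
      IsAdmissibleElement E Φ (algebraMap ↥(maximalRealSubfield E) E a * δ) ∧
      ∀ v ∈ S, IsSquare (algebraMap ↥(maximalRealSubfield E) (v.adicCompletion ↥(maximalRealSubfield E)) (a : ↥(maximalRealSubfield E)) /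
        (κ v : v.adicCompletion ↥(maximalRealSubfield E))) := by
  classical
  -- the member of `Φ` (if any) of the pair of embeddings of `E` above the real place `w` of `E⁺`, and the sign it prescribes
  let τ₀ : InfinitePlace ↥(maximalRealSubfield E) → (E →+* ℂ) := fun w => ((IsCMField.equivInfinitePlace E).symm w).embedding
  let τsel : InfinitePlace ↥(maximalRealSubfield E) → (E →+* ℂ) := fun w => if τ₀ w ∈ Φ then τ₀ w else conjugate (τ₀ w)
  let r : InfinitePlace ↥(maximalRealSubfield E) → ℝ := fun w => -((τsel w) δ).im
  have hr : ∀ w, w.IsReal → r w ≠ 0 := fun w _ =>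
    neg_ne_zero.2 (im_embedding_ne_zero_of_complexConj_eq_neg hδ hδ0 _)
  obtain ⟨a, ha, hsq⟩ := Literature.NumberTheory.NumberFields.exists_sign_at_isReal_forall_isSquare_div S κ r hr
  refine ⟨a, ⟨?_, ?_, fun τ hτ => ?_⟩, hsq⟩
  · exact mul_ne_zero ((map_ne_zero _).2 a.ne_zero) hδ0
  · rw [map_mul, hδ, mul_neg]
    congr 1
    exact congrArg (· * δ) (IsCMField.complexConj_apply_eq_self (K := E) (a : ↥(maximalRealSubfield E)))
  · -- `τ ∈ Φ` lies above the real place `w := (mk τ)|_{E⁺}`, and `τsel w = τ`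
    set w : InfinitePlace ↥(maximalRealSubfield E) := (InfinitePlace.mk τ).comap (algebraMap ↥(maximalRealSubfield E) E) with hw_def
    have hW : (IsCMField.equivInfinitePlace E).symm w = InfinitePlace.mk τ := by
      rw [Equiv.symm_apply_eq, IsCMField.equivInfinitePlace_apply]
    have hsel : τsel w = τ := by
      have h0 : τ₀ w = (InfinitePlace.mk τ).embedding := by simp only [τ₀, hW]
      simp only [τsel, h0]
      rcases embedding_mk_eq τ with h | h
      · rw [h, if_pos hτ]
      · rw [h, if_neg (hΦ τ hτ), (ComplexEmbedding.involutive_conjugate E τ)]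
    have hsgn := ha w (IsTotallyReal.isReal w)
    simp only [r, hsel] at hsgn
    -- `Im τ(a δ) = σ_w(a) · Im τ(δ) < 0`
    rw [map_mul, embedding_algebraMap_eq_ofReal_embedding_of_isReal τ, Complex.im_ofReal_mul]
    nlinarith [hsgn]

/-- **One place.**  For a finite place `v` of `E⁺` and `κ ∈ (E⁺_v)ˣ` there is `a ∈ (E⁺)ˣ` with `a·δ` admissible for `Φ` and `a / κ ∈ (E⁺_v)²`.
[cite: Liu2021, Def. 4.12] [cite: CasselsFrohlichANT1967, Ch. II §6 Lemma (weak approximation)] -/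
theorem exists_isAdmissibleElement_algebraMap_mul_isSquare_div (Φ : Set (E →+* ℂ)) (hΦ : ∀ φ ∈ Φ, conjugate φ ∉ Φ)
    {δ : E} (hδ : IsCMField.complexConj E δ = -δ) (hδ0 : δ ≠ 0)
    (v : HeightOneSpectrum (𝓞 ↥(maximalRealSubfield E))) (κ : (v.adicCompletion ↥(maximalRealSubfield E))ˣ) :
    ∃ a : (↥(maximalRealSubfield E))ˣ,
      IsAdmissibleElement E Φ (algebraMap ↥(maximalRealSubfield E) E a * δ) ∧
      IsSquare (algebraMap ↥(maximalRealSubfield E) (v.adicCompletion ↥(maximalRealSubfield E)) (a : ↥(maximalRealSubfield E)) /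
        (κ : v.adicCompletion ↥(maximalRealSubfield E))) := by
  classical
  obtain ⟨a, ha, hsq⟩ := exists_isAdmissibleElement_algebraMap_mul_forall_isSquare_div Φ hΦ hδ hδ0 {v}
    (Function.update (fun w : HeightOneSpectrum (𝓞 ↥(maximalRealSubfield E)) ↦
      (1 : (w.adicCompletion ↥(maximalRealSubfield E))ˣ)) v κ)
  refine ⟨a, ha, ?_⟩
  have h := hsq v (Finset.mem_singleton_self v)
  rwa [Function.update_self] at h

/-- **One place, unit form**: `a·δ` admissible for `Φ` and `a = κ · s²` in `E⁺_v` for some `s ∈ (E⁺_v)ˣ` — `a` has the SQUARE CLASS of `κ`, hence the class of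
`κ` modulo every local norm group `⊇ (E⁺_vˣ)²` (e.g. `Nm_{E_w/E⁺_v} E_wˣ`, the line classes of [GelbartRogawski1991, Lem. 5.1.2]).
[cite: Liu2021, Def. 4.12] [cite: CasselsFrohlichANT1967, Ch. II §6 Lemma (weak approximation)] -/
theorem exists_isAdmissibleElement_algebraMap_mul_eq_mul_sq (Φ : Set (E →+* ℂ)) (hΦ : ∀ φ ∈ Φ, conjugate φ ∉ Φ)
    {δ : E} (hδ : IsCMField.complexConj E δ = -δ) (hδ0 : δ ≠ 0)
    (v : HeightOneSpectrum (𝓞 ↥(maximalRealSubfield E))) (κ : (v.adicCompletion ↥(maximalRealSubfield E))ˣ) :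
    ∃ (a : (↥(maximalRealSubfield E))ˣ) (s : (v.adicCompletion ↥(maximalRealSubfield E))ˣ),
      IsAdmissibleElement E Φ (algebraMap ↥(maximalRealSubfield E) E a * δ) ∧
      algebraMap ↥(maximalRealSubfield E) (v.adicCompletion ↥(maximalRealSubfield E)) (a : ↥(maximalRealSubfield E)) =
        (κ : v.adicCompletion ↥(maximalRealSubfield E)) * (s : v.adicCompletion ↥(maximalRealSubfield E)) ^ 2 := by
  obtain ⟨a, ha, u, hu⟩ := exists_isAdmissibleElement_algebraMap_mul_isSquare_div Φ hΦ hδ hδ0 v κ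
  have ha0 : algebraMap ↥(maximalRealSubfield E) (v.adicCompletion ↥(maximalRealSubfield E)) (a : ↥(maximalRealSubfield E)) ≠ 0 :=
    (map_ne_zero _).2 a.ne_zero
  have hu0 : u ≠ 0 := by
    rintro rfl
    rw [mul_zero, div_eq_zero_iff] at hu
    exact hu.elim ha0 κ.ne_zero
  refine ⟨a, Units.mk0 u hu0, ha, ?_⟩
  rw [Units.val_mk0, sq, ← hu, mul_div_cancel₀ _ κ.ne_zero]

/-- **CM-type form** (`Φ` a CM type in the tree's sense, `φ ∈ Φ ↔ φ̄ ∉ Φ` — e.g. `Φ_μ = hμ.cmType.1` of a conjugate-symplectic `μ`): an admissible `a·δ` with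
`a` in the prescribed square classes at `S`. [cite: Liu2021, Def. 4.12] -/
theorem exists_isAdmissibleElement_algebraMap_mul_forall_isSquare_div_of_cmType (Φ : Set (E →+* ℂ))
    (hΦ : ∀ φ, φ ∈ Φ ↔ conjugate φ ∉ Φ) {δ : E} (hδ : IsCMField.complexConj E δ = -δ) (hδ0 : δ ≠ 0)
    (S : Finset (HeightOneSpectrum (𝓞 ↥(maximalRealSubfield E))))
    (κ : ∀ v : HeightOneSpectrum (𝓞 ↥(maximalRealSubfield E)), (v.adicCompletion ↥(maximalRealSubfield E))ˣ) :
    ∃ a : (↥(maximalRealSubfield E))ˣ,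
      IsAdmissibleElement E Φ (algebraMap ↥(maximalRealSubfield E) E a * δ) ∧
      ∀ v ∈ S, IsSquare (algebraMap ↥(maximalRealSubfield E) (v.adicCompletion ↥(maximalRealSubfield E)) (a : ↥(maximalRealSubfield E)) /
        (κ v : v.adicCompletion ↥(maximalRealSubfield E))) :=
  exists_isAdmissibleElement_algebraMap_mul_forall_isSquare_div Φ (fun φ hφ => (hΦ φ).mp hφ) hδ hδ0 S κ

end Literature.AlgebraicGeometry.Liu2021

end
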